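import Summits.BirchSwinnertonDyer.BirchSwinnertonDyer.Theorems.Rank2ObservatoryQuadField17
import Summits.BirchSwinnertonDyer.BirchSwinnertonDyer.Theorems.Rank2Observatory2DescZ2RowKit
import Summits.BirchSwinnertonDyer.BirchSwinnertonDyer.Theorems.Rank2Observatory2DescNormPrime
import HarnessLib

/-!
# BirchSwinnertonDyer — rank ≥ 2 observatory: the places `2`, `3`, `13`, `17`, `19` of `ℚ(√17)` (split data for row 428298m1)

HONEST FRAMING: per-curve certified theorems and census instruments; no claim on BSD in rank ≥ 2.

Per-field place data of the successor instrument KERNEL-2DESC-Z2 for `K = ℚ(ω)`, `ω² = ω + 4`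
(`K = ℚ(√17)`, `…QuadField17`), the `2`-division field of the third ℤ/2-torsion row `428298m1`:
the residue maps `𝓞 K → ℤ/13` (`ω ↦ 6, 8`), `𝓞 K → ℤ/19` (`ω ↦ 7, 13`) and `𝓞 K → ℤ/8`
(`ω ↦ 4, 5`) (`MonicQuad.exists_ringHom_of_root`); the split data
`P13a, P13b : SplitPrime (𝓞 K) 13` (`13 = (1 + 2ω)(−3 + 2ω)`, norms `−13`),
`P19a, P19b : SplitPrime (𝓞 K) 19` (`19 = (5 + 2ω)(7 − 2ω)`, norms `19`) and
`P24, P25 : SplitTwo (𝓞 K)` (`2 = (2 + ω)(3 − ω)`, norms `2`), each with its kernel certificate from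
the primality of the generator (`…Z2RowKit.dvd_of_res_eq_zero`, `dvd_of_res_sq_ne_one`), the
correction bits `c = qrOf (res π')` (`0, 0` at `13`; `1, 1` at `19`) and residues `ρ = res π' = 7`
at `2`; plus the remaining support generators of the row: the inert prime `3` (norm `9`, no ring map
`𝓞 K → ℤ/3` since `X² − X − 4` has no root mod `3`; `…2DescNormPrime.prime_of_natAbs_norm_eq_prime_pow`)
and the ramified `√17 = −1 + 2ω` (norm `−17`). Field data: kit pari j208916.
Sorry-free; axioms `propext`, `Classical.choice`, `Quot.sound`.
[cite: Cassels1991LecturesEllipticCurves, §15] [cite: Marcus2018, Ch. 3 Thm. 27]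
-/

-- single-conjunct summit: `Summit.BirchSwinnertonDyer.BirchSwinnertonDyer.…` repeats the name by design
set_option linter.dupNamespace false

noncomputable section

open scoped NumberField

open Polynomial Module NumberField

namespace Summit.BirchSwinnertonDyer.BirchSwinnertonDyer.Rank2Observatory.TwoDescZ2

namespace QuadField17

/-! ## Residue maps -/

/-- A ring hom `ψ : 𝓞 K →+* ZMod 13` with `ψ θ = 8` exists (`8` is a root of the minimal polynomial of `θ` mod `13`). [folklore] -/
theorem exists_psi13_8 : ∃ ψ : 𝓞 (QuadField (-1) (-4)) →+* ZMod 13, ψ (MonicQuad.thetaInt aeval_ω) = 8 :=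
  MonicQuad.exists_ringHom_of_root irreducible aeval_ω finrank_eq hsq (8 : ZMod 13) (by decide)

/-- A ring hom `ψ : 𝓞 K →+* ZMod 19` with `ψ θ = 13` exists (`13` is a root of the minimal polynomial of `θ` mod `19`). [folklore] -/
theorem exists_psi19_13 : ∃ ψ : 𝓞 (QuadField (-1) (-4)) →+* ZMod 19, ψ (MonicQuad.thetaInt aeval_ω) = 13 :=
  MonicQuad.exists_ringHom_of_root irreducible aeval_ω finrank_eq hsq (13 : ZMod 19) (by decide)

/-- A ring hom `ψ : 𝓞 K →+* ZMod 8` with `ψ θ = 4` exists (`4` is a root of the minimal polynomial of `θ` mod `8`). [folklore] -/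
theorem exists_psi8_4 : ∃ ψ : 𝓞 (QuadField (-1) (-4)) →+* ZMod 8, ψ (MonicQuad.thetaInt aeval_ω) = 4 :=
  MonicQuad.exists_ringHom_of_root irreducible aeval_ω finrank_eq hsq (4 : ZMod 8) (by decide)

/-- A ring hom `ψ : 𝓞 K →+* ZMod 8` with `ψ θ = 5` exists (`5` is a root of the minimal polynomial of `θ` mod `8`). [folklore] -/
theorem exists_psi8_5 : ∃ ψ : 𝓞 (QuadField (-1) (-4)) →+* ZMod 8, ψ (MonicQuad.thetaInt aeval_ω) = 5 :=
  MonicQuad.exists_ringHom_of_root irreducible aeval_ω finrank_eq hsq (5 : ZMod 8) (by decide)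

/-- `res₁₃⁶ : ω ↦ 6 (mod 13)`. -/
def res13a : 𝓞 (QuadField (-1) (-4)) →+* ZMod 13 := exists_psi13.choose
/-- The residue map `res13a` at `θ` (its defining property, by `choose_spec`). [folklore] -/
theorem res13a_ω : res13a (MonicQuad.thetaInt aeval_ω) = 6 := exists_psi13.choose_spec
/-- `res₁₃⁸ : ω ↦ 8 (mod 13)`. -/
def res13b : 𝓞 (QuadField (-1) (-4)) →+* ZMod 13 := exists_psi13_8.choose
/-- The residue map `res13b` at `θ` (its defining property, by `choose_spec`). [folklore] -/
theorem res13b_ω : res13b (MonicQuad.thetaInt aeval_ω) = 8 := exists_psi13_8.choose_spec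
/-- `res₁₉⁷ : ω ↦ 7 (mod 19)`. -/
def res19a : 𝓞 (QuadField (-1) (-4)) →+* ZMod 19 := exists_psi19.choose
/-- The residue map `res19a` at `θ` (its defining property, by `choose_spec`). [folklore] -/
theorem res19a_ω : res19a (MonicQuad.thetaInt aeval_ω) = 7 := exists_psi19.choose_spec
/-- `res₁₉¹³ : ω ↦ 13 (mod 19)`. -/
def res19b : 𝓞 (QuadField (-1) (-4)) →+* ZMod 19 := exists_psi19_13.choose
/-- The residue map `res19b` at `θ` (its defining property, by `choose_spec`). [folklore] -/
theorem res19b_ω : res19b (MonicQuad.thetaInt aeval_ω) = 13 := exists_psi19_13.choose_spec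
/-- `res₈⁴ : ω ↦ 4 (mod 8)`. -/
def res84 : 𝓞 (QuadField (-1) (-4)) →+* ZMod 8 := exists_psi8_4.choose
/-- The residue map `res84` at `θ` (its defining property, by `choose_spec`). [folklore] -/
theorem res84_ω : res84 (MonicQuad.thetaInt aeval_ω) = 4 := exists_psi8_4.choose_spec
/-- `res₈⁵ : ω ↦ 5 (mod 8)`. -/
def res85 : 𝓞 (QuadField (-1) (-4)) →+* ZMod 8 := exists_psi8_5.choose
/-- The residue map `res85` at `θ` (its defining property, by `choose_spec`). [folklore] -/
theorem res85_ω : res85 (MonicQuad.thetaInt aeval_ω) = 5 := exists_psi8_5.choose_spec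

/-! ## Generators -/

/-- `π₁₃ = 1 + 2ω` (norm `−13`, `ω ≡ 6`). -/
def g13a : 𝓞 (QuadField (-1) (-4)) := MonicQuad.lin aeval_ω 1 2
/-- `π₁₃' = −3 + 2ω` (norm `−13`, `ω ≡ 8`). -/
def g13b : 𝓞 (QuadField (-1) (-4)) := MonicQuad.lin aeval_ω (-3) 2
/-- `π₁₉ = 5 + 2ω` (norm `19`, `ω ≡ 7`). -/
def g19a : 𝓞 (QuadField (-1) (-4)) := MonicQuad.lin aeval_ω 5 2
/-- `π₁₉' = 7 − 2ω` (norm `19`, `ω ≡ 13`). -/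
def g19b : 𝓞 (QuadField (-1) (-4)) := MonicQuad.lin aeval_ω 7 (-2)
/-- `π₂ = 2 + ω` (norm `2`, `ω ≡ 4 (mod 8)` at `𝔭³`). -/
def g2a : 𝓞 (QuadField (-1) (-4)) := MonicQuad.lin aeval_ω 2 1
/-- `π₂' = 3 − ω` (norm `2`, `ω ≡ 5 (mod 8)` at `𝔭'³`). -/
def g2b : 𝓞 (QuadField (-1) (-4)) := MonicQuad.lin aeval_ω 3 (-1)
/-- The inert prime `3` (norm `9`). -/
def three : 𝓞 (QuadField (-1) (-4)) := MonicQuad.lin aeval_ω 3 0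
/-- `√17 = −1 + 2ω` (norm `−17`, the ramified prime). -/
def r17 : 𝓞 (QuadField (-1) (-4)) := MonicQuad.lin aeval_ω (-1) 2

/-- The place generator `g13a` is prime in `𝓞 K` (prime-norm certificate via `MonicQuad.lin_prime_of_prime`). [folklore] -/
theorem g13a_prime : Prime g13a :=
  MonicQuad.lin_prime_of_prime irreducible aeval_ω finrank_eq 1 2 (n := -13)
    (by norm_num [MonicQuad.normForm]) (by norm_num)
/-- The place generator `g13b` is prime in `𝓞 K` (prime-norm certificate via `MonicQuad.lin_prime_of_prime`). [folklore] -/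
theorem g13b_prime : Prime g13b :=
  MonicQuad.lin_prime_of_prime irreducible aeval_ω finrank_eq (-3) 2 (n := -13)
    (by norm_num [MonicQuad.normForm]) (by norm_num)
/-- The place generator `g19a` is prime in `𝓞 K` (prime-norm certificate via `MonicQuad.lin_prime_of_prime`). [folklore] -/
theorem g19a_prime : Prime g19a :=
  MonicQuad.lin_prime_of_prime irreducible aeval_ω finrank_eq 5 2 (n := 19)
    (by norm_num [MonicQuad.normForm]) (by norm_num)
/-- The place generator `g19b` is prime in `𝓞 K` (prime-norm certificate via `MonicQuad.lin_prime_of_prime`). [folklore] -/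
theorem g19b_prime : Prime g19b :=
  MonicQuad.lin_prime_of_prime irreducible aeval_ω finrank_eq 7 (-2) (n := 19)
    (by norm_num [MonicQuad.normForm]) (by norm_num)
/-- The place generator `g2a` is prime in `𝓞 K` (prime-norm certificate via `MonicQuad.lin_prime_of_prime`). [folklore] -/
theorem g2a_prime : Prime g2a :=
  MonicQuad.lin_prime_of_prime irreducible aeval_ω finrank_eq 2 1 (n := 2)
    (by norm_num [MonicQuad.normForm]) (by norm_num)
/-- The place generator `g2b` is prime in `𝓞 K` (prime-norm certificate via `MonicQuad.lin_prime_of_prime`). [folklore] -/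
theorem g2b_prime : Prime g2b :=
  MonicQuad.lin_prime_of_prime irreducible aeval_ω finrank_eq 3 (-1) (n := 2)
    (by norm_num [MonicQuad.normForm]) (by norm_num)
/-- The ramified-prime generator `r17` is prime in `𝓞 K` (prime-norm certificate). [folklore] -/
theorem r17_prime : Prime r17 :=
  MonicQuad.lin_prime_of_prime irreducible aeval_ω finrank_eq (-1) 2 (n := -17)
    (by norm_num [MonicQuad.normForm]) (by norm_num)
/-- `3` is inert: norm `3²` and no ring map `𝓞 K → ℤ/3` exists (`X² − X − 4` has no root mod `3`).
[cite: Marcus2018, Ch. 3, Thm. 22] -/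
theorem three_prime : Prime three :=
  TwoDescCubic.prime_of_natAbs_norm_eq_prime_pow (p := 3) (k := 2) (by norm_num) (Or.inl rfl)
    (by rw [three, MonicQuad.natAbs_norm_lin irreducible aeval_ω finrank_eq 3 0 (n := 9)
      (by norm_num [MonicQuad.normForm])]; rfl)
    (fun ψ _ => (show ∀ t : ZMod 3, t ^ 2 + ((-1 : ℤ) : ZMod 3) * t + ((-4 : ℤ) : ZMod 3) ≠ 0 by decide)
      _ (MonicQuad.map_thetaInt_root aeval_ω ψ))

/-- `13 = π₁₃ π₁₃'`. -/
theorem thirteen_eq : ((13 : ℕ) : 𝓞 (QuadField (-1) (-4))) = g13a * g13b := by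
  simp only [g13a, g13b, MonicQuad.lin]
  push_cast
  linear_combination (-(4 : 𝓞 (QuadField (-1) (-4)))) * ωi_rel

/-- `19 = π₁₉ π₁₉'`. -/
theorem nineteen_eq : ((19 : ℕ) : 𝓞 (QuadField (-1) (-4))) = g19a * g19b := by
  simp only [g19a, g19b, MonicQuad.lin]
  push_cast
  linear_combination (4 : 𝓞 (QuadField (-1) (-4))) * ωi_rel

/-- `2 = π₂ π₂'`. -/
theorem two_eq : (2 : 𝓞 (QuadField (-1) (-4))) = g2a * g2b := by
  simp only [g2a, g2b, MonicQuad.lin]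
  push_cast
  linear_combination (1 : 𝓞 (QuadField (-1) (-4))) * ωi_rel

/-! ## Split data at `13` -/

/-- The prime `(13, ω − 6)`: `π = 1 + 2ω`, `π' = −3 + 2ω`, residue map `ω ↦ 6`. -/
def P13a : SplitPrime (𝓞 (QuadField (-1) (-4))) 13 where
  π := g13a
  π' := g13b
  res := res13a
  hℓ := thirteen_eq
  hπ := by rw [g13a, MonicQuad.map_lin aeval_ω _ res13a_ω]; decide
  hπ' := by rw [g13b, MonicQuad.map_lin aeval_ω _ res13a_ω]; decide
  hker := dvd_of_res_eq_zero res13a g13a_prime (by rw [g13a, MonicQuad.map_lin aeval_ω _ res13a_ω]; decide)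

/-- The prime `(13, ω − 8)`: `π = −3 + 2ω`, `π' = 1 + 2ω`, residue map `ω ↦ 8`. -/
def P13b : SplitPrime (𝓞 (QuadField (-1) (-4))) 13 where
  π := g13b
  π' := g13a
  res := res13b
  hℓ := by rw [mul_comm]; exact thirteen_eq
  hπ := by rw [g13b, MonicQuad.map_lin aeval_ω _ res13b_ω]; decide
  hπ' := by rw [g13a, MonicQuad.map_lin aeval_ω _ res13b_ω]; decide
  hker := dvd_of_res_eq_zero res13b g13b_prime (by rw [g13b, MonicQuad.map_lin aeval_ω _ res13b_ω]; decide)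

/-- The residue map of the split-prime datum `P13a` at `θ`. [folklore] -/
theorem P13a_res_theta : P13a.res (MonicQuad.thetaInt aeval_ω) = 6 := res13a_ω
/-- The residue map of the split-prime datum `P13b` at `θ`. [folklore] -/
theorem P13b_res_theta : P13b.res (MonicQuad.thetaInt aeval_ω) = 8 := res13b_ω
/-- The residue map of the split-prime datum `P13a` on `p + qθ`. [folklore] -/
theorem P13a_res_lin (p q : ℤ) : P13a.res (MonicQuad.lin aeval_ω p q) = (p : ZMod 13) + (q : ZMod 13) * 6 :=
  MonicQuad.map_lin aeval_ω _ res13a_ω p q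
/-- The residue map of the split-prime datum `P13b` on `p + qθ`. [folklore] -/
theorem P13b_res_lin (p q : ℤ) : P13b.res (MonicQuad.lin aeval_ω p q) = (p : ZMod 13) + (q : ZMod 13) * 8 :=
  MonicQuad.map_lin aeval_ω _ res13b_ω p q
/-- Correction bit at `(13, ω − 6)`: `res π' = −3 + 2·6 = 9 = 3²`. -/
theorem P13a_c : qrOf (P13a.res P13a.π') = 0 := by
  rw [qrOf_eq_sqb, show P13a.res P13a.π' = 9 by
    rw [show P13a.π' = g13b from rfl, g13b, P13a_res_lin]; decide]
  decide
/-- Correction bit at `(13, ω − 8)`: `res π' = 1 + 2·8 ≡ 4 = 2²`. -/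
theorem P13b_c : qrOf (P13b.res P13b.π') = 0 := by
  rw [qrOf_eq_sqb, show P13b.res P13b.π' = 4 by
    rw [show P13b.π' = g13a from rfl, g13a, P13b_res_lin]; decide]
  decide

/-! ## Split data at `19` -/

/-- The prime `(19, ω − 7)`: `π = 5 + 2ω`, `π' = 7 − 2ω`, residue map `ω ↦ 7`. -/
def P19a : SplitPrime (𝓞 (QuadField (-1) (-4))) 19 where
  π := g19a
  π' := g19b
  res := res19a
  hℓ := nineteen_eq
  hπ := by rw [g19a, MonicQuad.map_lin aeval_ω _ res19a_ω]; decide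
  hπ' := by rw [g19b, MonicQuad.map_lin aeval_ω _ res19a_ω]; decide
  hker := dvd_of_res_eq_zero res19a g19a_prime (by rw [g19a, MonicQuad.map_lin aeval_ω _ res19a_ω]; decide)

/-- The prime `(19, ω − 13)`: `π = 7 − 2ω`, `π' = 5 + 2ω`, residue map `ω ↦ 13`. -/
def P19b : SplitPrime (𝓞 (QuadField (-1) (-4))) 19 where
  π := g19b
  π' := g19a
  res := res19b
  hℓ := by rw [mul_comm]; exact nineteen_eq
  hπ := by rw [g19b, MonicQuad.map_lin aeval_ω _ res19b_ω]; decide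
  hπ' := by rw [g19a, MonicQuad.map_lin aeval_ω _ res19b_ω]; decide
  hker := dvd_of_res_eq_zero res19b g19b_prime (by rw [g19b, MonicQuad.map_lin aeval_ω _ res19b_ω]; decide)

/-- The residue map of the split-prime datum `P19a` at `θ`. [folklore] -/
theorem P19a_res_theta : P19a.res (MonicQuad.thetaInt aeval_ω) = 7 := res19a_ω
/-- The residue map of the split-prime datum `P19b` at `θ`. [folklore] -/
theorem P19b_res_theta : P19b.res (MonicQuad.thetaInt aeval_ω) = 13 := res19b_ω
/-- The residue map of the split-prime datum `P19a` on `p + qθ`. [folklore] -/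
theorem P19a_res_lin (p q : ℤ) : P19a.res (MonicQuad.lin aeval_ω p q) = (p : ZMod 19) + (q : ZMod 19) * 7 :=
  MonicQuad.map_lin aeval_ω _ res19a_ω p q
/-- The residue map of the split-prime datum `P19b` on `p + qθ`. [folklore] -/
theorem P19b_res_lin (p q : ℤ) : P19b.res (MonicQuad.lin aeval_ω p q) = (p : ZMod 19) + (q : ZMod 19) * 13 :=
  MonicQuad.map_lin aeval_ω _ res19b_ω p q
/-- Correction bit at `(19, ω − 7)`: `res π' = 7 − 2·7 ≡ 12`, a non-square. -/
theorem P19a_c : qrOf (P19a.res P19a.π') = 1 := by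
  rw [qrOf_eq_sqb, show P19a.res P19a.π' = 12 by
    rw [show P19a.π' = g19b from rfl, g19b, P19a_res_lin]; decide]
  decide
/-- Correction bit at `(19, ω − 13)`: `res π' = 5 + 2·13 ≡ 12`, a non-square. -/
theorem P19b_c : qrOf (P19b.res P19b.π') = 1 := by
  rw [qrOf_eq_sqb, show P19b.res P19b.π' = 12 by
    rw [show P19b.π' = g19a from rfl, g19a, P19b_res_lin]; decide]
  decide

/-! ## Split data at `2` -/

/-- The prime `(2, ω)` with `ω ≡ 4 (mod 𝔭³)`: `π = 2 + ω`, `π' = 3 − ω`, residue map `ω ↦ 4 (mod 8)`. -/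
def P24 : SplitTwo (𝓞 (QuadField (-1) (-4))) where
  π := g2a
  π' := g2b
  res := res84
  h2 := two_eq
  hπ := by rw [g2a, MonicQuad.map_lin aeval_ω _ res84_ω]; decide
  hπ' := by rw [g2b, MonicQuad.map_lin aeval_ω _ res84_ω]; decide
  hker := dvd_of_res_sq_ne_one res84 g2a_prime (by rw [g2a, MonicQuad.map_lin aeval_ω _ res84_ω]; decide)

/-- The prime `(2, ω − 1)` with `ω ≡ 5 (mod 𝔭'³)`: `π = 3 − ω`, `π' = 2 + ω`, residue map `ω ↦ 5 (mod 8)`. -/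
def P25 : SplitTwo (𝓞 (QuadField (-1) (-4))) where
  π := g2b
  π' := g2a
  res := res85
  h2 := by rw [mul_comm]; exact two_eq
  hπ := by rw [g2b, MonicQuad.map_lin aeval_ω _ res85_ω]; decide
  hπ' := by rw [g2a, MonicQuad.map_lin aeval_ω _ res85_ω]; decide
  hker := dvd_of_res_sq_ne_one res85 g2b_prime (by rw [g2b, MonicQuad.map_lin aeval_ω _ res85_ω]; decide)

/-- The residue map of the split-prime datum `P24` on `p + qθ`. [folklore] -/
theorem P24_res_lin (p q : ℤ) : P24.res (MonicQuad.lin aeval_ω p q) = (p : ZMod 8) + (q : ZMod 8) * 4 :=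
  MonicQuad.map_lin aeval_ω _ res84_ω p q
/-- The residue map of the split-prime datum `P25` on `p + qθ`. [folklore] -/
theorem P25_res_lin (p q : ℤ) : P25.res (MonicQuad.lin aeval_ω p q) = (p : ZMod 8) + (q : ZMod 8) * 5 :=
  MonicQuad.map_lin aeval_ω _ res85_ω p q
/-- `ρ = res π'` at `(2, ω)`: `3 − 4 ≡ 7 (mod 8)`. -/
theorem P24_rho : P24.res P24.π' = 7 := by
  rw [show P24.π' = g2b from rfl, g2b, P24_res_lin]; decide
/-- `ρ = res π'` at `(2, ω − 1)`: `2 + 5 = 7 (mod 8)`. -/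
theorem P25_rho : P25.res P25.π' = 7 := by
  rw [show P25.π' = g2a from rfl, g2a, P25_res_lin]; decide

end QuadField17

end Summit.BirchSwinnertonDyer.BirchSwinnertonDyer.Rank2Observatory.TwoDescZ2

end
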